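import Literature.RepresentationTheory.ModularTensorCategories.SU2SMatrix

/-!
# The Verlinde formula, `d_a d_b = Σ N d_c` and associativity for the `SU(2)_k` data

Topic `Literature/RepresentationTheory/ModularTensorCategories` (definition item `defn-ModularDatum`; second
batch of PROVED `ModularDatum` axioms for the explicit `SU(2)_k` data of `SU2LevelK.lean`).

Everything rests on the CHARACTER IDENTITY at the special angles `θ_x = π(x+1)/(k+2)`,
`x ∈ {0,…,k}`:
`sin((a+1)θ_x) sin((b+1)θ_x) = sin θ_x · Σ_c N_{ab}^c sin((c+1)θ_x)` (`sin_mul_sin_eq_sum_fusionN`),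
i.e. `χ_a χ_b = Σ_c N_{ab}^c χ_c` for `χ_a(x) = S_{ax}/S_{0x}`: the admissible `c` are
`|a-b|, |a-b|+2, …, min(a+b, 2k-a-b)` (`sum_range_filter_adm`), the sum telescopes, and the truncation
is invisible at these angles because `cos((2k-a-b+2)θ_x) = cos(2π(x+1) - (a+b+2)θ_x) = cos((a+b+2)θ_x)`.
Consequences: the **Verlinde formula** `N_{ab}^c = Σ_x S_{ax}S_{bx}S_{cx}/S_{0x}` (`fusionN_eq_verlinde`,
using `S² = 1` from `SU2SMatrix.lean`), the dimension rule `d_a d_b = Σ_c N_{ab}^c d_c`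
(`qdim_mul_qdim`, the identity at `x = 0`) and associativity of the truncated product
(`fusionN_assoc`), whence `su2FusionRules k : FusionRules (Fin (k+1))` with every axiom proved.
[cite: Gannon2023, eq. (6.1.1b) (Verlinde) with (6.2.2a), (6.2.2c) (A₁ level k)]
-/

noncomputable section

open Finset
open scoped ComplexConjugate

namespace Literature.RepresentationTheory.ModularTensorCategories.SU2LevelK

/-- The admissible third labels for `b ≤ a ≤ k`: `c ∈ {0..k}` with `Adm k a b c` are exactly
`c = (a-b) + 2j`, `0 ≤ j ≤ (min(a+b, 2k-a-b) - (a-b))/2`. [cite: Gannon2023, eq. (6.2.2c)] -/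
theorem range_filter_adm (k : ℕ) {a b : ℕ} (hb : b ≤ a) (ha : a ≤ k) :
    (range (k + 1)).filter (fun c => Adm k a b c) =
      (range ((min (a + b) (2 * k - (a + b)) - (a - b)) / 2 + 1)).image (fun j => a - b + 2 * j) := by
  ext c
  simp only [mem_filter, mem_range, mem_image, Adm]
  constructor
  · rintro ⟨hc, h1, h2, h3, h4, h5⟩
    refine ⟨(c - (a - b)) / 2, ?_, ?_⟩
    all_goals omega
  · rintro ⟨j, hj, rfl⟩
    omega

/-- Reindexing a sum against the fusion multiplicities along the admissible progression.
[cite: Gannon2023, eq. (6.2.2c)] -/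
theorem sum_ite_adm (k : ℕ) {a b : ℕ} (hb : b ≤ a) (ha : a ≤ k) (f : ℕ → ℝ) :
    ∑ c ∈ range (k + 1), (if Adm k a b c then f c else 0) =
      ∑ j ∈ range ((min (a + b) (2 * k - (a + b)) - (a - b)) / 2 + 1), f (a - b + 2 * j) := by
  rw [← sum_filter, range_filter_adm k hb ha, sum_image]
  intro x _ y _ h
  simpa using h

/-- Telescoping: `Σ_{j ≤ J} 2 sin θ sin((n+2j+1)θ) = cos(nθ) - cos((n+2J+2)θ)`. [folklore] -/
theorem sum_two_sin_mul_sin (θ : ℝ) (n J : ℕ) :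
    ∑ j ∈ range (J + 1), 2 * Real.sin θ * Real.sin ((n + 2 * j + 1) * θ) =
      Real.cos (n * θ) - Real.cos ((n + 2 * J + 2) * θ) := by
  have hterm : ∀ j : ℕ, 2 * Real.sin θ * Real.sin ((n + 2 * j + 1) * θ) =
      Real.cos ((n + 2 * j : ℕ) * θ) - Real.cos ((n + 2 * (j + 1) : ℕ) * θ) := by
    intro j
    have e1 : ((n + 2 * j : ℕ) : ℝ) * θ = (n + 2 * j + 1) * θ - θ := by push_cast; ring
    have e2 : ((n + 2 * (j + 1) : ℕ) : ℝ) * θ = (n + 2 * j + 1) * θ + θ := by push_cast; ring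
    rw [e1, e2, Real.cos_sub, Real.cos_add]
    ring
  simp_rw [hterm]
  rw [Finset.sum_range_sub' (fun j => Real.cos ((n + 2 * j : ℕ) * θ))]
  congr 2
  all_goals push_cast; ring

/-- **Character identity** of `SU(2)_k` at the special angles: for labels `a, b, x ≤ k` and
`θ = π(x+1)/(k+2)`, `sin((a+1)θ) sin((b+1)θ) = sin θ · Σ_c N_{ab}^c sin((c+1)θ)`
(truncated Clebsch–Gordan; the dropped terms cancel since `cos((2k-a-b+2)θ) = cos((a+b+2)θ)`).
[cite: Gannon2023, eq. (6.2.1c) and (6.2.2a,c) (S_{λμ}/S_{0μ} are characters; A₁ level k)] -/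
theorem sin_mul_sin_eq_sum_fusionN (k : ℕ) (a b x : Fin (k + 1)) :
    Real.sin (Real.pi * ((a : ℕ) + 1) * ((x : ℕ) + 1) / (k + 2)) *
        Real.sin (Real.pi * ((b : ℕ) + 1) * ((x : ℕ) + 1) / (k + 2)) =
      Real.sin (Real.pi * ((x : ℕ) + 1) / (k + 2)) *
        ∑ c : Fin (k + 1), (fusionN k a b c : ℝ) *
          Real.sin (Real.pi * ((c : ℕ) + 1) * ((x : ℕ) + 1) / (k + 2)) := by
  -- reduce to natural-number labels with `b ≤ a`
  suffices key : ∀ a b : ℕ, b ≤ a → a ≤ k →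
      Real.sin (Real.pi * (a + 1) * ((x : ℕ) + 1) / (k + 2)) *
          Real.sin (Real.pi * (b + 1) * ((x : ℕ) + 1) / (k + 2)) =
        Real.sin (Real.pi * ((x : ℕ) + 1) / (k + 2)) *
          ∑ c ∈ range (k + 1), (if Adm k a b c then
            Real.sin (Real.pi * (c + 1) * ((x : ℕ) + 1) / (k + 2)) else 0) by
    have hsum : ∀ a' b' : Fin (k + 1), ∑ c : Fin (k + 1), (fusionN k a' b' c : ℝ) *
          Real.sin (Real.pi * ((c : ℕ) + 1) * ((x : ℕ) + 1) / (k + 2)) =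
        ∑ c ∈ range (k + 1), (if Adm k a' b' c then
            Real.sin (Real.pi * (c + 1) * ((x : ℕ) + 1) / (k + 2)) else 0) := by
      intro a' b'
      rw [← Fin.sum_univ_eq_sum_range (fun c => (if Adm k a' b' c then
            Real.sin (Real.pi * (c + 1) * ((x : ℕ) + 1) / (k + 2)) else 0)) (k + 1)]
      refine Finset.sum_congr rfl (fun c _ => ?_)
      unfold fusionN
      split_ifs <;> simp
    rcases le_total (b : ℕ) a with hba | hab
    · rw [hsum, key a b hba (Nat.lt_succ_iff.mp a.isLt)]
    · rw [mul_comm, hsum, key b a hab (Nat.lt_succ_iff.mp b.isLt)]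
      congr 1
      refine Finset.sum_congr rfl (fun c _ => ?_)
      simp only [show Adm k (b : ℕ) a c ↔ Adm k a b c from adm_comm k]
  intro a b hb ha
  set θ : ℝ := Real.pi * ((x : ℕ) + 1) / (k + 2) with hθ
  have hk : (0 : ℝ) < k + 2 := by positivity
  -- rewrite all angles as multiples of θ
  have hang : ∀ n : ℝ, Real.pi * n * ((x : ℕ) + 1) / (k + 2) = n * θ := by
    intro n; rw [hθ]; ring
  have hangc : ∀ c : ℕ, Real.pi * ((c : ℝ) + 1) * ((x : ℕ) + 1) / (k + 2) = ((c : ℝ) + 1) * θ :=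
    fun c => hang _
  simp_rw [hangc]
  rw [sum_ite_adm k hb ha (fun c => Real.sin (((c : ℝ) + 1) * θ))]
  set J : ℕ := (min (a + b) (2 * k - (a + b)) - (a - b)) / 2 with hJ
  -- multiply through by 2 and telescope
  have htel := sum_two_sin_mul_sin θ (a - b) J
  have h2 : 2 * (Real.sin ((a + 1) * θ) * Real.sin ((b + 1) * θ)) =
      Real.cos ((a - b : ℕ) * θ) - Real.cos ((a + b + 2) * θ) := by
    have e1 : ((a - b : ℕ) : ℝ) * θ = (a + 1) * θ - (b + 1) * θ := by push_cast [hb]; ring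
    have e2 : ((a : ℝ) + b + 2) * θ = (a + 1) * θ + (b + 1) * θ := by ring
    rw [e1, e2, Real.cos_sub, Real.cos_add]; ring
  -- the truncation: cos((lo + 2J + 2) θ) = cos((a+b+2) θ)
  have hpar : (a - b) + 2 * J = min (a + b) (2 * k - (a + b)) := by omega
  have hend : Real.cos ((((a - b : ℕ) : ℝ) + 2 * J + 2) * θ) = Real.cos ((a + b + 2) * θ) := by
    have hcast : ((a - b : ℕ) : ℝ) + 2 * J = ((min (a + b) (2 * k - (a + b)) : ℕ) : ℝ) := by
      exact_mod_cast hpar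
    rw [hcast]
    rcases le_or_gt (a + b) k with hle | hgt
    · rw [min_eq_left (by omega)]; push_cast; ring_nf
    · rw [min_eq_right (by omega)]
      have : (((2 * k - (a + b) : ℕ) : ℝ) + 2) * θ = ((x : ℕ) + 1 : ℕ) * (2 * Real.pi) - (a + b + 2) * θ := by
        rw [hθ]; push_cast [show a + b ≤ 2 * k by omega]; field_simp; ring
      rw [this, Real.cos_nat_mul_two_pi_sub]
  -- assemble
  have hsum2 : 2 * (Real.sin θ * ∑ j ∈ range (J + 1), Real.sin ((((a - b + 2 * j : ℕ) : ℝ) + 1) * θ)) =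
      Real.cos ((a - b : ℕ) * θ) - Real.cos ((a + b + 2) * θ) := by
    rw [← hend, ← htel, Finset.mul_sum, Finset.mul_sum]
    refine Finset.sum_congr rfl (fun j _ => ?_)
    push_cast; ring
  linarith [h2, hsum2]

/-- The character identity in S-matrix form: `Σ_c N_{ab}^c S_{cx} = S_{ax} S_{bx} / S_{0x}`.
[cite: Gannon2023, eq. (6.1.1b) and Lemma 6.1.4 (columns of S are eigenvectors of N_a with eigenvalue S_{ab}/S_{0b})] -/
theorem sum_fusionN_mul_sMat (k : ℕ) (a b x : Fin (k + 1)) :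
    ∑ c : Fin (k + 1), (fusionN k a b c : ℂ) * sMat k c x = sMat k a x * sMat k b x / sMat k 0 x := by
  have hk : (0 : ℝ) < k + 2 := by positivity
  have hsin : 0 < Real.sin (Real.pi * ((x : ℕ) + 1) / (k + 2)) := by
    apply Real.sin_pos_of_pos_of_lt_pi (by positivity)
    rw [div_lt_iff₀ hk]
    have : ((x : ℕ) : ℝ) + 1 ≤ k + 1 := by exact_mod_cast x.isLt
    nlinarith [Real.pi_pos]
  have hs0 : sMat k 0 x =
      ((Real.sqrt (2 / (k + 2)) * Real.sin (Real.pi * ((x : ℕ) + 1) / (k + 2)) : ℝ) : ℂ) := by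
    rw [sMat_apply]; congr 2; rw [Fin.val_zero]; push_cast; ring
  have hsq : (0 : ℝ) < Real.sqrt (2 / (k + 2)) := Real.sqrt_pos.mpr (by positivity)
  have hs0ne : sMat k 0 x ≠ 0 := by
    rw [hs0]; exact_mod_cast (mul_pos hsq hsin).ne'
  rw [eq_div_iff hs0ne, hs0]
  simp only [sMat_apply]
  have key := sin_mul_sin_eq_sum_fusionN k a b x
  set s : ℝ := Real.sqrt (2 / (k + 2)) with hs
  have hpull : ∑ c : Fin (k + 1), (fusionN k a b c : ℝ) *
        (s * Real.sin (Real.pi * ((c : ℕ) + 1) * ((x : ℕ) + 1) / (k + 2))) =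
      s * ∑ c : Fin (k + 1), (fusionN k a b c : ℝ) *
        Real.sin (Real.pi * ((c : ℕ) + 1) * ((x : ℕ) + 1) / (k + 2)) := by
    rw [Finset.mul_sum]
    exact Finset.sum_congr rfl (fun c _ => by ring)
  have goal_real : (∑ c : Fin (k + 1), (fusionN k a b c : ℝ) *
        (s * Real.sin (Real.pi * ((c : ℕ) + 1) * ((x : ℕ) + 1) / (k + 2)))) *
      (s * Real.sin (Real.pi * ((x : ℕ) + 1) / (k + 2))) =
      s * Real.sin (Real.pi * ((a : ℕ) + 1) * ((x : ℕ) + 1) / (k + 2)) *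
        (s * Real.sin (Real.pi * ((b : ℕ) + 1) * ((x : ℕ) + 1) / (k + 2))) := by
    rw [hpull, show s * Real.sin (Real.pi * ((a : ℕ) + 1) * ((x : ℕ) + 1) / (k + 2)) *
        (s * Real.sin (Real.pi * ((b : ℕ) + 1) * ((x : ℕ) + 1) / (k + 2))) =
      s * s * (Real.sin (Real.pi * ((a : ℕ) + 1) * ((x : ℕ) + 1) / (k + 2)) *
        Real.sin (Real.pi * ((b : ℕ) + 1) * ((x : ℕ) + 1) / (k + 2))) by ring, key]
    ring
  exact_mod_cast goal_real

/-- **Verlinde formula for `SU(2)_k`**: `N_{ab}^c = Σ_x S_{ax} S_{bx} conj(S_{cx}) / S_{0x}` for the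
explicit data `fusionN`, `sMat`. [cite: Gannon2023, eq. (6.1.1b) with (6.2.2a), (6.2.2c)] -/
theorem fusionN_eq_verlinde (k : ℕ) (a b c : Fin (k + 1)) :
    (fusionN k a b c : ℂ) = ∑ x : Fin (k + 1), sMat k a x * sMat k b x * conj (sMat k c x) / sMat k 0 x := by
  have hconj : ∀ x, conj (sMat k c x) = sMat k x c := fun x => by
    rw [sMat_apply, sMat_apply, Complex.conj_ofReal]; congr 3; ring
  have hone := sMat_mul_sMat k
  calc (fusionN k a b c : ℂ)
      = ∑ c' : Fin (k + 1), (fusionN k a b c' : ℂ) * (sMat k * sMat k) c' c := by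
        rw [hone, Finset.sum_eq_single c]
        · simp
        · intro c' _ hc'; rw [Matrix.one_apply_ne hc', mul_zero]
        · exact fun h => (h (Finset.mem_univ _)).elim
    _ = ∑ x : Fin (k + 1), (∑ c' : Fin (k + 1), (fusionN k a b c' : ℂ) * sMat k c' x) * sMat k x c := by
        simp only [Matrix.mul_apply, Finset.mul_sum, Finset.sum_mul]
        rw [Finset.sum_comm]
        refine Finset.sum_congr rfl (fun x _ => Finset.sum_congr rfl (fun c' _ => ?_))
        ring
    _ = ∑ x : Fin (k + 1), sMat k a x * sMat k b x * conj (sMat k c x) / sMat k 0 x := by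
        refine Finset.sum_congr rfl (fun x _ => ?_)
        rw [sum_fusionN_mul_sMat, hconj]
        ring

/-- **`d_a d_b = Σ_c N_{ab}^c d_c`** for `d_a = [a+1]` (the character identity at `x = 0`).
[cite: Kitaev2006, App. E.2 eq. (d_a d_b = Σ N d_c)] -/
theorem qdim_mul_qdim (k : ℕ) (a b : Fin (k + 1)) :
    qdim k a * qdim k b = ∑ c : Fin (k + 1), (fusionN k a b c : ℝ) * qdim k c := by
  have key := sin_mul_sin_eq_sum_fusionN k a b 0
  have hsin : Real.sin (Real.pi / (k + 2)) ≠ 0 := by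
    have hk : (0 : ℝ) < k + 2 := by positivity
    refine (Real.sin_pos_of_pos_of_lt_pi (by positivity) ?_).ne'
    rw [div_lt_iff₀ hk]; nlinarith [Real.pi_pos]
  have hq : ∀ c : Fin (k + 1), qdim k c =
      Real.sin (Real.pi * ((c : ℕ) + 1) * (((0 : Fin (k + 1)) : ℕ) + 1) / (k + 2)) /
        Real.sin (Real.pi / (k + 2)) := by
    intro c; unfold qdim qInt; rw [Fin.val_zero]; congr 2; push_cast; ring
  have h0 : Real.sin (Real.pi * (((0 : Fin (k + 1)) : ℕ) + 1) / (k + 2)) =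
      Real.sin (Real.pi / (k + 2)) := by
    rw [Fin.val_zero]; push_cast; ring_nf
  rw [h0] at key
  simp_rw [hq]
  rw [div_mul_div_comm, key, div_eq_iff (mul_ne_zero hsin hsin), Finset.mul_sum, Finset.sum_mul]
  refine Finset.sum_congr rfl (fun c _ => ?_)
  field_simp

/-- **Associativity of the `SU(2)_k` fusion rules**: `Σ_e N_{ab}^e N_{ec}^d = Σ_f N_{bc}^f N_{af}^d`
(from the Verlinde formula and `S² = 1`). [cite: Gannon2023, Def. 6.1.3 and Lemma 6.1.4 (fusion ring of A₁ level k)] -/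
theorem fusionN_assoc (k : ℕ) (a b c d : Fin (k + 1)) :
    ∑ e : Fin (k + 1), fusionN k a b e * fusionN k e c d =
      ∑ f : Fin (k + 1), fusionN k b c f * fusionN k a f d := by
  -- both sides equal Σ_y S_ay S_by S_cy S_yd / S_0y² after casting to ℂ
  have hcast : ((∑ e : Fin (k + 1), fusionN k a b e * fusionN k e c d : ℕ) : ℂ) =
      ((∑ f : Fin (k + 1), fusionN k b c f * fusionN k a f d : ℕ) : ℂ) := by
    push_cast
    have hL : ∀ e : Fin (k + 1), (fusionN k a b e : ℂ) * (fusionN k e c d : ℂ) =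
        ∑ y : Fin (k + 1), (fusionN k a b e : ℂ) * sMat k e y * (sMat k c y * conj (sMat k d y) / sMat k 0 y) := by
      intro e
      rw [fusionN_eq_verlinde k e c d, Finset.mul_sum]
      refine Finset.sum_congr rfl (fun y _ => ?_); ring
    have hR : ∀ f : Fin (k + 1), (fusionN k b c f : ℂ) * (fusionN k a f d : ℂ) =
        ∑ y : Fin (k + 1), (fusionN k b c f : ℂ) * sMat k f y * (sMat k a y * conj (sMat k d y) / sMat k 0 y) := by
      intro f
      rw [fusionN_eq_verlinde k a f d, Finset.mul_sum]
      refine Finset.sum_congr rfl (fun y _ => ?_); ring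
    simp_rw [hL, hR]
    rw [Finset.sum_comm, Finset.sum_comm (s := (Finset.univ : Finset (Fin (k + 1))))
      (f := fun f y => (fusionN k b c f : ℂ) * sMat k f y * (sMat k a y * conj (sMat k d y) / sMat k 0 y))]
    refine Finset.sum_congr rfl (fun y _ => ?_)
    rw [← Finset.sum_mul, ← Finset.sum_mul, sum_fusionN_mul_sMat, sum_fusionN_mul_sMat]
    ring
  exact_mod_cast hcast

/-- **The fusion rules of `SU(2)_k`** as a `FusionRules (Fin (k+1))` (unit `0`, all labels
self-dual, `N = fusionN k`), with EVERY axiom proved (associativity by `fusionN_assoc`).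
[cite: Gannon2023, eq. (6.2.2c) and Def. 6.1.3 (the fusion ring of A₁ level k)] -/
def su2FusionRules (k : ℕ) : FusionRules (Fin (k + 1)) where
  unit := 0
  dual := id
  N := fusionN k
  dual_dual := fun _ => rfl
  N_unit_left := fusionN_unit_left k
  N_comm := fusionN_comm k
  N_assoc := fusionN_assoc k
  N_dual := fusionN_dual k
  N_conj := fun _ _ _ => rfl

/-- `su2FusionRules` has `N = fusionN`. [folklore] -/
@[simp] theorem su2FusionRules_N (k : ℕ) : (su2FusionRules k).N = fusionN k := rfl

end Literature.RepresentationTheory.ModularTensorCategories.SU2LevelK
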